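import Literature.Probability.FitznerVanDerHofstad2017.NobleBoundingEventsF
import Literature.Probability.FitznerVanDerHofstad2017.NobleBoundingEventsProduct
import HarnessLib

/-!
# [FvdH17] §4.4, the product bound (4.65) for every `N ≥ 1`, PROVED in the single-level reading

Source: R. Fitzner, R. van der Hofstad, *Mean-field behavior for nearest-neighbor percolation in `d > 10`*,
Electron. J. Probab. **22** (2017) no. 43 [FvdH17], §4.4, display (4.65) (arXiv:1506.07977v2 p. 43 = EJP p. 40),
quoted in full in `NobleBoundingEventsProduct`:
`Ξ^{(N)}_p(x) ≤ Σ_{t⃗,w⃗,z⃗,b⃗} p^N P_p(F₀(b₀,w₀,z₁) ∩ {b̄₀ ∉ C̃₀}) Π_{i=1}^{N-1} P_p^{b̲_{i-1}}(F_i(b_{i-1},t_i,z_i,b_i,w_i,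
z_{i+1}) ∩ {b̄_i ∉ C̃_i}) P_p^{b̲_{N-1}}(F_N(b_{N-1},t_N,z_N,x))`.

The tree's `Ξ^{(N+1)}(x) = 𝒩^{∅,∅}(𝒩^{N} nobleKerXi)({0},0,x)` is bounded by iterating the one-level engine
`nobleOp_le_tsum_of_kernel_le` (module `NobleBoundingEventsProduct`) with the level bounds (4.63)
(`nobleKerXi_le_tsum_eventFN`), (4.64) (`probOff_laceE_inter_le_tsum_eventF`, module `NobleBoundingEventsF`)
and the level-`0` bound (`measure_nobleCell_inter_le_tsum_eventF0'`):

  `nobleXiT_succ_le :  Ξ^{(N+1)}(x) ≤ Σ_{b₀} Σ_{z₁} J(b₀) · (Σ_{w₀} P_p(F₀(b₀,w₀,z₁) ∩ {b̄₀ ∉ C̃₀})) · K_N(b₀,z₁)`,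

where `K_n = nobleLevelK d p x n` is the iterated level factor: `K₀(b,z) = Σ_t P^{b̲}(F_N(b,t,z,x))` and
`K_{n+1}(b,z) = Σ_{b'} Σ_{z'} J(b') · G(b,b',z,z') · K_n(b',z')` with the ONE-LEVEL FACTOR `G = nobleLevelG`:
for `z' ∉ {b̲, b̲'}` (`b = (b̲,b̄)` the previous bond, `b' = (b̲',b̄')` the level's own bond) it is the printed
factor without its indicator `{b̄' ∉ C̃}`, `Σ_{t,w} P^{b̲}(F(b,t,z,b',w,z'))` (which vanishes for `z' = b̄'` by the
constraint `{z' ∉ b'}` of (4.57)–(4.59)); for `z' ∈ {b̲, b̲'}` it is `Σ_t P^{b̲}(F_N(b,t,z,b̲'))`, the bound (4.63) of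
the bare cell.  READING (recorded as DIVERGENCE D59 (b) of the b2b-lace register; no claim about the print beyond
its text): the level-`(i+1)` point `z_{i+1}` ranges over `C̃_i = C̃^{b_i}_i(b̄_{i-1}) ∪ {b̲_{i-1}}` ((3.26)), and
(4.64) covers `z_{i+1} ∈ C̃^{b_i}_i(b̄_{i-1})`, `z_{i+1} ∉ b_i`; the typed factor therefore treats `z_{i+1} = b̲_{i-1}`
(and, harmlessly, `z_{i+1} = b̲_i`, where the next factor vanishes: `nobleLevelK_self_eq_zero`) by (4.63) instead.
Consequently the right side of `nobleXiT_succ_le` is the printed right side of (4.65) (with the indicators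
`{b̄_i ∉ C̃_i}`, `1 ≤ i ≤ N-1`, dropped) PLUS the nonnegative terms with some `z_{i+1} = b̲_{i-1}`.

Nothing in this module is a cited hypothesis.
-/

noncomputable section

namespace Literature.Probability.FitznerVanDerHofstad2017

open _root_.MeasureTheory Literature.Barriers.CriticalPhenomena Literature.Probability.Percolation
open Literature.Probability.LatticeModels _root_.SimpleGraph
open scoped ENNReal

variable {d : ℕ}

/-! ### Emptiness of the bounding events at excluded points -/

/-- `F((u,v),t,z,(y,y'),w,z') = ∅` when `u ∈ {t,w,z,y}` (the constraint `b̲_{i-1} ∉ {t_i,w_i,z_i,b̲_i}`).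
[cite: FitznerVanDerHofstad2017, (4.57)–(4.59) (arXiv:1506.07977v2 p. 41; EJP 22 (2017) no. 43 p. 38)] -/
theorem eventF_eq_empty_of_mem {u v t z y y' w z' : Site d} (h : u ∈ ({t, w, z, y} : Set (Site d))) :
    eventF u v t z y y' w z' = ∅ := by
  ext ω
  simp only [eventF, eventF1, eventF2, eventF3, Set.mem_union, Set.mem_inter_iff, Set.mem_setOf_eq, h,
    not_true_eq_false, and_false, or_self, Set.mem_empty_iff_false]

/-- `F((u,v),t,z,(y,y'),w,z') = ∅` when `z' ∈ (y,y')` (the constraint `z_{i+1} ∉ b_i`).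
[cite: FitznerVanDerHofstad2017, (4.57)–(4.59) (arXiv:1506.07977v2 p. 41; EJP 22 (2017) no. 43 p. 38)] -/
theorem eventF_eq_empty_of_mem_bond {u v t z y y' w z' : Site d} (h : z' ∈ s(y, y')) :
    eventF u v t z y y' w z' = ∅ := by
  ext ω
  simp only [eventF, eventF1, eventF2, eventF3, Set.mem_union, Set.mem_inter_iff, Set.mem_setOf_eq, h,
    not_true_eq_false, and_false, false_and, or_self, Set.mem_empty_iff_false]

/-! ### The one-level factor -/

/-- **The one-level factor `G((u,v),(y,y'),z,z')`** of the typed (4.65) (level `i`, previous bond `b_{i-1} = (u,v)`,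
own bond `b_i = (y,y')`, `z_i = z`, `z_{i+1} = z'`): `Σ_{t,w} P^{u}(F((u,v),t,z,(y,y'),w,z'))` for `z' ∉ {u, y}`
(the printed factor, without `{b̄_i ∉ C̃_i}`), and `Σ_t P^{u}(F_N((u,v),t,z,y))` (the bound (4.63) of the bare
cell) at the two points `z' ∈ {u, y} = {b̲_{i-1}, b̲_i}`.
[cite: FitznerVanDerHofstad2017, (4.63)–(4.65) (arXiv:1506.07977v2 pp. 42–43; EJP 22 (2017) no. 43 pp. 39–40)] -/
def nobleLevelG (d : ℕ) (p : unitInterval) (u v y y' z z' : Site d) : ℝ≥0∞ :=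
  if z' = u ∨ z' = y then ∑' t : Site d, probOff d p (bondsAt {u}) (eventFN u v t z y)
  else ∑' t : Site d, ∑' w : Site d, probOff d p (bondsAt {u}) (eventF u v t z y y' w z')

/-- Unfolding lemma at the two special points. [folklore] -/
theorem nobleLevelG_of_special (p : unitInterval) {u v y y' z z' : Site d} (h : z' = u ∨ z' = y) :
    nobleLevelG d p u v y y' z z' = ∑' t : Site d, probOff d p (bondsAt {u}) (eventFN u v t z y) := by
  rw [nobleLevelG, if_pos h]

/-- Unfolding lemma at a generic point. [folklore] -/
theorem nobleLevelG_of_not_special (p : unitInterval) {u v y y' z z' : Site d} (h : ¬ (z' = u ∨ z' = y)) :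
    nobleLevelG d p u v y y' z z' =
      ∑' t : Site d, ∑' w : Site d, probOff d p (bondsAt {u}) (eventF u v t z y y' w z') := by
  rw [nobleLevelG, if_neg h]

/-- `G((u,v),(y,y'),u,z') = 0`: the point `z_i = b̲_{i-1}` never contributes.
[cite: FitznerVanDerHofstad2017, (4.57)–(4.59) (arXiv:1506.07977v2 p. 41; EJP 22 (2017) no. 43 p. 38)] -/
theorem nobleLevelG_self_eq_zero (p : unitInterval) (u v y y' z' : Site d) : nobleLevelG d p u v y y' u z' = 0 := by
  by_cases h : z' = u ∨ z' = y
  · rw [nobleLevelG_of_special p h]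
    simp only [eventFN_self_eq_empty, probOff_empty_event, tsum_zero]
  · rw [nobleLevelG_of_not_special p h]
    have he : ∀ t w : Site d, eventF u v t u y y' w z' = ∅ := fun t w =>
      eventF_eq_empty_of_mem (by simp only [Set.mem_insert_iff, Set.mem_singleton_iff, true_or, or_true])
    simp only [he, probOff_empty_event, tsum_zero]

/-- **The level-`i` cell bound, linear in `𝟙_{C̃_{i-1}}`** (`1 ≤ i ≤ N-1`; outer data `(B(u),{u})`, `u ≠ v`):
`P_p(nobleCell^{B(u),{u}}(A,v,(y,y')) ∩ {z' ∈ C̃^{(y,y')}(v)(ω_{B(u)ᶜ}) ∪ {u}}) ≤ Σ_z 𝟙_A(z) · G((u,v),(y,y'),z,z')`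
for EVERY `z'`: by (4.64) for `z' ∉ {u,y,y'}`, by (4.63) for `z' ∈ {u,y}`, and `= 0` for `z' = y'` (the cell has
`y' ∉ C̃ ∪ {u}`).
[cite: FitznerVanDerHofstad2017, (4.63)–(4.64) (arXiv:1506.07977v2 p. 42; EJP 22 (2017) no. 43 p. 39)] -/
theorem measure_nobleCell_inner_le_tsum (p : unitInterval) {A : Set (Site d)} {u v y y' : Site d} (huv : u ≠ v)
    (z' : Site d) :
    bondPercolation (zdGraph d) p (nobleCell (bondsAt {u}) {u} A v y y' ∩
        {ω | z' ∈ restrCluster y y' v (offBonds (bondsAt {u}) ω) ∪ {u}}) ≤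
      ∑' z : Site d, A.indicator (fun z => nobleLevelG d p u v y y' z z') z := by
  classical
  by_cases hz'y' : z' = y'
  · have h0 : nobleCell (bondsAt {u}) {u} A v y y' ∩
        {ω | z' ∈ restrCluster y y' v (offBonds (bondsAt {u}) ω) ∪ {u}} = ∅ := by
      ext ω
      simp only [Set.mem_inter_iff, mem_nobleCell_iff, Set.mem_setOf_eq, Set.mem_empty_iff_false, iff_false,
        not_and]
      intro h hz
      exact h.2 (hz'y' ▸ hz)
    rw [h0, measure_empty]
    exact zero_le
  by_cases hb : z' = u ∨ z' = y
  · calc bondPercolation (zdGraph d) p (nobleCell (bondsAt {u}) {u} A v y y' ∩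
            {ω | z' ∈ restrCluster y y' v (offBonds (bondsAt {u}) ω) ∪ {u}})
        ≤ bondPercolation (zdGraph d) p (occursOff (bondsAt {u}) (laceE A v y)) :=
          measure_mono fun ω hω => hω.1.1
      _ = probOff d p (bondsAt {u}) (laceE A v y) := (probOff_def p _ _).symm
      _ ≤ ∑' z : Site d, ∑' t : Site d, A.indicator (fun z => probOff d p (bondsAt {u}) (eventFN u v t z y)) z :=
          probOff_laceE_le_tsum_eventFN p huv
      _ = ∑' z : Site d, A.indicator (fun z => nobleLevelG d p u v y y' z z') z := by
          refine tsum_congr fun z => ?_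
          rw [tsum_setIndicator_apply]
          by_cases hz : z ∈ A
          · rw [Set.indicator_of_mem hz, Set.indicator_of_mem hz, nobleLevelG_of_special p hb]
          · rw [Set.indicator_of_notMem hz, Set.indicator_of_notMem hz]
  · have hzb : z' ∉ s(y, y') := by
      rw [Sym2.mem_iff, not_or]
      exact ⟨fun h => hb (Or.inr h), hz'y'⟩
    have hz'u : z' ≠ u := fun h => hb (Or.inl h)
    calc bondPercolation (zdGraph d) p (nobleCell (bondsAt {u}) {u} A v y y' ∩
            {ω | z' ∈ restrCluster y y' v (offBonds (bondsAt {u}) ω) ∪ {u}})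
        ≤ probOff d p (bondsAt {u}) (laceE A v y ∩ openConn v z') := by
          rw [probOff_def]
          refine measure_mono fun ω hω => ?_
          rw [mem_occursOff_iff]
          obtain ⟨hcell, hz⟩ := hω
          refine ⟨hcell.1, ?_⟩
          rcases hz with hz | hz
          · rw [mem_restrCluster_iff] at hz
            exact hz.mono (openGraph_mono fun _ h => h.1)
          · exact absurd hz hz'u
      _ ≤ ∑' z : Site d, ∑' t : Site d, ∑' w : Site d,
            A.indicator (fun z => probOff d p (bondsAt {u}) (eventF u v t z y y' w z')) z :=
          probOff_laceE_inter_le_tsum_eventF p huv hzb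
      _ = ∑' z : Site d, A.indicator (fun z => nobleLevelG d p u v y y' z z') z := by
          refine tsum_congr fun z => ?_
          by_cases hz : z ∈ A
          · simp only [Set.indicator_of_mem hz, nobleLevelG_of_not_special p hb]
          · simp only [Set.indicator_of_notMem hz, tsum_zero]

/-! ### The iterated level factor and the bound on `𝒩ⁿ nobleKerXi` -/

/-- **The iterated level factor `K_n(b,z)`** (`x` fixed): `K₀(b,z) = Σ_t P^{b̲}(F_N(b,t,z,x))`,
`K_{n+1}(b,z) = Σ_{b'} Σ_{z'} J(b') · G(b,b',z,z') · K_n(b',z')` — the right side of (4.65) below level `0`,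
read from the innermost level outwards.
[cite: FitznerVanDerHofstad2017, (4.65) (arXiv:1506.07977v2 p. 43; EJP 22 (2017) no. 43 p. 40)] -/
def nobleLevelK (d : ℕ) (p : unitInterval) (x : Site d) : ℕ → Site d × Site d → Site d → ℝ≥0∞
  | 0 => fun b z => ∑' t : Site d, probOff d p (bondsAt {b.1}) (eventFN b.1 b.2 t z x)
  | n + 1 => fun b z => ∑' b' : Site d × Site d, ∑' z' : Site d,
      ENNReal.ofReal (bondJ d p (b'.2 - b'.1)) * (nobleLevelG d p b.1 b.2 b'.1 b'.2 z z' * nobleLevelK d p x n b' z')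

/-- Unfolding lemma (`n = 0`). [folklore] -/
theorem nobleLevelK_zero (p : unitInterval) (x : Site d) (b : Site d × Site d) (z : Site d) :
    nobleLevelK d p x 0 b z = ∑' t : Site d, probOff d p (bondsAt {b.1}) (eventFN b.1 b.2 t z x) := rfl

/-- Unfolding lemma (`n + 1`). [folklore] -/
theorem nobleLevelK_succ (p : unitInterval) (x : Site d) (n : ℕ) (b : Site d × Site d) (z : Site d) :
    nobleLevelK d p x (n + 1) b z = ∑' b' : Site d × Site d, ∑' z' : Site d,
      ENNReal.ofReal (bondJ d p (b'.2 - b'.1)) *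
        (nobleLevelG d p b.1 b.2 b'.1 b'.2 z z' * nobleLevelK d p x n b' z') := rfl

/-- `K_n(b, b̲) = 0`: the point `z_i = b̲_{i-1}` never contributes (so the special value of `G` at `z' = b̲'` is
immaterial). [cite: FitznerVanDerHofstad2017, (4.57)–(4.60) (arXiv:1506.07977v2 p. 41; EJP 22 (2017) no. 43 p. 38)] -/
theorem nobleLevelK_self_eq_zero (p : unitInterval) (x : Site d) (n : ℕ) (b : Site d × Site d) :
    nobleLevelK d p x n b b.1 = 0 := by
  cases n with
  | zero =>
    rw [nobleLevelK_zero]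
    simp only [eventFN_self_eq_empty, probOff_empty_event, tsum_zero]
  | succ n =>
    rw [nobleLevelK_succ]
    simp only [nobleLevelG_self_eq_zero, zero_mul, mul_zero, tsum_zero]

/-- **`(𝒩ⁿ nobleKerXi)(u)(A,v,x) ≤ Σ_z 𝟙_A(z) · K_n((u,v),z)`** for `u ≠ v`: induction on `n`, the base being
(4.63) and the step the one-level engine with `measure_nobleCell_inner_le_tsum`.
[cite: FitznerVanDerHofstad2017, (4.63)–(4.65) (arXiv:1506.07977v2 pp. 42–43; EJP 22 (2017) no. 43 pp. 39–40)] -/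
theorem nobleIter_nobleKerXi_le (p : unitInterval) (x : Site d) (n : ℕ) :
    ∀ b : Site d × Site d, b.1 ≠ b.2 → ∀ A : Set (Site d),
      nobleIter d p (nobleKerXi d p) n b.1 A b.2 x ≤ ∑' z : Site d, A.indicator (nobleLevelK d p x n b) z := by
  classical
  induction n with
  | zero =>
    intro b hb A
    rw [nobleIter_zero]
    refine (nobleKerXi_le_tsum_eventFN p hb).trans (le_of_eq (tsum_congr fun z => ?_))
    exact tsum_setIndicator_apply A (fun t z => probOff d p (bondsAt {b.1}) (eventFN b.1 b.2 t z x)) z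
  | succ n ih =>
    intro b hb A
    rw [nobleIter_succ, nobleOpW_apply]
    refine (nobleOp_le_tsum_of_kernel_le p (bondsAt {b.1}) {b.1} (nobleIter d p (nobleKerXi d p) n) A b.2 x
      (nobleLevelK d p x n) ih).trans ?_
    calc ∑' b' : Site d × Site d, ∑' z' : Site d, ENNReal.ofReal (bondJ d p (b'.2 - b'.1)) *
          (bondPercolation (zdGraph d) p (nobleCell (bondsAt {b.1}) {b.1} A b.2 b'.1 b'.2 ∩
              {ω | z' ∈ restrCluster b'.1 b'.2 b.2 (offBonds (bondsAt {b.1}) ω) ∪ {b.1}}) *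
            nobleLevelK d p x n b' z')
        ≤ ∑' b' : Site d × Site d, ∑' z' : Site d, ENNReal.ofReal (bondJ d p (b'.2 - b'.1)) *
            ((∑' z : Site d, A.indicator (fun z => nobleLevelG d p b.1 b.2 b'.1 b'.2 z z') z) *
              nobleLevelK d p x n b' z') :=
          ENNReal.tsum_le_tsum fun b' => ENNReal.tsum_le_tsum fun z' =>
            mul_le_mul' le_rfl (mul_le_mul' (measure_nobleCell_inner_le_tsum p hb z') le_rfl)
      _ = ∑' b' : Site d × Site d, ∑' z' : Site d, ∑' z : Site d, A.indicator (fun z =>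
            ENNReal.ofReal (bondJ d p (b'.2 - b'.1)) *
              (nobleLevelG d p b.1 b.2 b'.1 b'.2 z z' * nobleLevelK d p x n b' z')) z := by
          refine tsum_congr fun b' => tsum_congr fun z' => ?_
          rw [← ENNReal.tsum_mul_right, ← ENNReal.tsum_mul_left]
          refine tsum_congr fun z => ?_
          by_cases hz : z ∈ A
          · simp only [Set.indicator_of_mem hz]
          · simp only [Set.indicator_of_notMem hz, zero_mul, mul_zero]
      _ = ∑' z : Site d, ∑' b' : Site d × Site d, ∑' z' : Site d, A.indicator (fun z =>
            ENNReal.ofReal (bondJ d p (b'.2 - b'.1)) *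
              (nobleLevelG d p b.1 b.2 b'.1 b'.2 z z' * nobleLevelK d p x n b' z')) z := by
          rw [show (∑' b' : Site d × Site d, ∑' z' : Site d, ∑' z : Site d, A.indicator (fun z =>
              ENNReal.ofReal (bondJ d p (b'.2 - b'.1)) *
                (nobleLevelG d p b.1 b.2 b'.1 b'.2 z z' * nobleLevelK d p x n b' z')) z) =
              ∑' b' : Site d × Site d, ∑' z : Site d, ∑' z' : Site d, A.indicator (fun z =>
                ENNReal.ofReal (bondJ d p (b'.2 - b'.1)) *
                  (nobleLevelG d p b.1 b.2 b'.1 b'.2 z z' * nobleLevelK d p x n b' z')) z from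
            tsum_congr fun b' => ENNReal.tsum_comm, ENNReal.tsum_comm]
      _ = ∑' z : Site d, A.indicator (nobleLevelK d p x (n + 1) b) z := by
          refine tsum_congr fun z => ?_
          by_cases hz : z ∈ A
          · simp only [Set.indicator_of_mem hz, nobleLevelK_succ]
          · simp only [Set.indicator_of_notMem hz, tsum_zero]

/-! ### (4.65) for every `N ≥ 1` -/

/-- **(4.65), all `N ≥ 1`, single-level reading.**
`Ξ^{(N+1)}_p(x) ≤ Σ_{b₀} Σ_{z₁} J(b₀) · (Σ_{w₀} P_p(F₀(b₀,w₀,z₁) ∩ {b̄₀ ∉ C̃₀})) · K_N(b₀,z₁)` with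
`K_N = nobleLevelK d p x N` the iterated level factor (module docstring): the printed right side of (4.65) for
`Ξ^{(N+1)}` — `J(b) = p𝟙{b is a bond}` at each of the `N+1` levels giving `p^{N+1}`, the indicators `{b̄_i ∉ C̃_i}`
of the inner levels dropped — plus the terms with some `z_{i+1} = b̲_{i-1}` (DIVERGENCE D59 (b)).
[cite: FitznerVanDerHofstad2017, (4.65) (arXiv:1506.07977v2 p. 43; EJP 22 (2017) no. 43 p. 40)] -/
theorem nobleXiT_succ_le (p : unitInterval) (N : ℕ) (x : Site d) :
    nobleXiT d p (N + 1) x ≤ ∑' b : Site d × Site d, ∑' z : Site d, ENNReal.ofReal (bondJ d p (b.2 - b.1)) *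
      ((∑' w : Site d, bondPercolation (zdGraph d) p (eventF0 b.1 b.2 w z ∩ {ω | b.2 ∉ restrCluster b.1 b.2 0 ω})) *
        nobleLevelK d p x N b z) := by
  classical
  have h1 : nobleXiT d p (N + 1) x = nobleOp d p ∅ ∅ (nobleIter d p (nobleKerXi d p) N) {0} 0 x := by
    rw [nobleXiT, if_neg (fun h => Nat.succ_ne_zero N h.1), nobleXiBT_succ]
  rw [h1]
  refine (nobleOp_le_tsum_of_kernel_le p ∅ ∅ (nobleIter d p (nobleKerXi d p) N) {0} 0 x (nobleLevelK d p x N)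
    (nobleIter_nobleKerXi_le p x N)).trans ?_
  refine ENNReal.tsum_le_tsum fun b => ENNReal.tsum_le_tsum fun z => mul_le_mul' le_rfl ?_
  by_cases hz : z = b.1
  · rw [hz, nobleLevelK_self_eq_zero, mul_zero, mul_zero]
  · exact mul_le_mul' (measure_nobleCell_inter_le_tsum_eventF0' p hz) le_rfl

end Literature.Probability.FitznerVanDerHofstad2017
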